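import Summits.PneNP.PneNP.Theorems.ChebyshevTracialDesignAmplitudeOneOfAllDirections
import Summits.PneNP.PneNP.Theorems.ChebyshevTracialDesignColourSymmetricReduction
import HarnessLib

/-!
# Cell pnp-psdrank, route `ChebyshevTracialDesign`: for COLOUR-SYMMETRIC masks the 𝒜₁ rung reduces to (CG_1′) in the colour-type-constant directions —
# brick 150b (crux `TracialDecayExp20`, stmt-PneNP-19878)

Brick 150b (prover g29; MEMO-32 §9). Composition of brick 148 §4 (`colourSymmetric_allDirections_reduction`: all directions ≤ type-constant directions
+ `8·G·n⁶·γ`) with brick 150 (`amplitudeOne_of_allDirections`: all-directions bound ⇒ 𝒜₁ rung) and the `r = 1` rung (`rectangleDecayExp_all_holds`,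
`γ = 20e^{−a·dq n}`):
* **`colourSymmetric_amplitudeOne_of_typeConstant`**: for a colouring `col : [n] → Fin k`, a mask `0 ≤ f ≤ G` invariant under colour-preserving relabelings
  commuting with the matching, IF the `M`-summed containment value is `≤ Btc` for every COLOUR-TYPE-CONSTANT field (`v_M(p)` depends only on
  `{col p, col π_Mp}`, `|v_M| ≤ 1`), THEN for every degree-one factor with `B_UB_Uᵀ ⪯ I` on the `t`-cuts and every `0 ⪯ Y_M ⪯ I`:
  `Σ_{U,M} W(U,M) f(U) tr(B_UB_UᵀY_M) ≤ 8·(Btc + 160·G·n⁶·e^{−a·dq n} + 60·G·n⁴·√P_{dq n−4})·r` (all large even `n`, crux-shape balanced designs).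
READING: for multi-block statistics `Ψ(|U∩H₁|,…,|U∩H_k|)` the ENTIRE 𝒜₁ rung (every dimension, any psd matching side) is reduced to ONE scalar family of
estimates: the design values of `Ψ·C_v²` for the `k(k+1)/2`-parameter type-constant containment forms `C_v`. WHAT THIS FILE DOES NOT DO: prove those
(open for `k ≥ 3`; `k = 2` is bricks 117–145); anything on `TracialDecayExp20` itself, psd rank of P_PM(K_n), or P vs NP.
[cite: GriblingDelaatLaurent2019, §5] [cite: Rothvoss2017, §2 and Lemma 7 (PDF pp. 5–8)] [cite: KeevashLifshitz2023, Thm. 1.8]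
Stature: support/instrument (kernel lane, no defs, axioms standard). Supports stmt-PneNP-19878.
-/

set_option linter.dupNamespace false -- `Summit.PneNP.PneNP.…`: summit = sub-problem (D-0017)

noncomputable section

namespace Summit.PneNP.PneNP.Theorems.ChebyshevTracialDesignColourSymmetricAmplitudeOne

open Finset Matrix Literature.Barriers.PneNP Literature.Combinatorics.Optimization
open Summit.PneNP.PneNP.Theorems.ChebyshevTracialDesignAmplitudeOneOfAllDirections (amplitudeOne_of_allDirections)
open Summit.PneNP.PneNP.Theorems.ChebyshevTracialDesignColourSymmetricReduction (colourSymmetric_allDirections_reduction)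
open Summit.PneNP.PneNP.Theorems.ChebyshevTracialDesignUnconditionalRungs (rectangleDecayExp_all_holds)

variable {n k : ℕ}

/-- **THE 𝒜₁ RUNG FOR COLOUR-SYMMETRIC AMPLITUDES FROM THE TYPE-CONSTANT DIRECTIONS (brick 150b).** [cite: GriblingDelaatLaurent2019, §5]
[cite: Rothvoss2017, §2 and Lemma 7 (PDF pp. 5–8)] [cite: KeevashLifshitz2023, Thm. 1.8] -/
theorem colourSymmetric_amplitudeOne_of_typeConstant :
    ∃ a : ℝ, 0 < a ∧ ∃ n₀ : ℕ, ∀ n : ℕ, n₀ ≤ n → Even n → ∀ {t : ℕ} {C : Finset ℕ} {w : ℕ → ℝ},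
    IsBalancedDesign n t (Tq n) (dq n) 20 C w →
    ∀ {k : ℕ} (col : Fin n → Fin k) (f : Finset (Fin n) → ℝ) {G : ℝ}, 0 ≤ G → (∀ U, 0 ≤ f U) → (∀ U, f U ≤ G) →
    (∀ (M : PMatch n) (g : Equiv.Perm (Fin n)), (∀ i, g (M.2.partner i) = M.2.partner (g i)) → (∀ i, col (g i) = col i) →
      ∀ U : Finset (Fin n), f (U.map g.toEmbedding) = f U) →
    ∀ {Btc : ℝ}, (∀ v : PMatch n → Fin n → ℝ, (∀ M p, |v M p| ≤ 1) →
      (∀ M p p', s(col p, col (M.2.partner p)) = s(col p', col (M.2.partner p')) → v M p = v M p') →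
      ∑ M : PMatch n, ∑ U : OddSet n, levelWeight n t C w U M * (f U.1 *
        (∑ p : Fin n, v M p * ((if p ∈ U.1 then (1 : ℝ) else 0) * (if M.2.partner p ∈ U.1 then (1 : ℝ) else 0))) ^ 2) ≤ Btc) →
    ∀ {r m : ℕ} (β : Fin n → Matrix (Fin r) (Fin m) ℝ),
    (∀ U : OddSet n, U.1.card = t →
      (1 - (∑ p, (if p ∈ U.1 then (1 : ℝ) else 0) • β p) * (∑ p, (if p ∈ U.1 then (1 : ℝ) else 0) • β p)ᵀ).PosSemidef) →
    ∀ (Y : PMatch n → Matrix (Fin r) (Fin r) ℝ), (∀ M, (Y M).PosSemidef ∧ (1 - Y M).PosSemidef) →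
    ∑ U : OddSet n, ∑ M : PMatch n, levelWeight n t C w U M *
        (f U.1 * ((∑ p, (if p ∈ U.1 then (1 : ℝ) else 0) • β p) * (∑ p, (if p ∈ U.1 then (1 : ℝ) else 0) • β p)ᵀ * Y M).trace) ≤
      8 * (Btc + 160 * G * (n : ℝ) ^ 6 * Real.exp (-(a * dq n)) +
        60 * G * (n : ℝ) ^ 4 * Real.sqrt (∏ i ∈ range ((dq n - 4) / 2 + 1), ((2 * i + 1 : ℝ) / ((n : ℝ) - 2 * i)))) * r := by
  classical
  obtain ⟨a, ha, n₁, hrung⟩ := rectangleDecayExp_all_holds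
  refine ⟨a, ha, max n₁ 256, ?_⟩
  intro n hn hev t C w hdes k col f G hG0 hf0 hfG hf Btc htc r m β hB Y hY
  have hn₁ : n₁ ≤ n := le_trans (le_max_left _ _) hn
  have hn256 : 256 ≤ n := le_trans (le_max_right _ _) hn
  have ht : Odd t := hdes.1.1
  have hR := hrung n hn₁ hev t C w hdes
  have hP : 0 ≤ Real.sqrt (∏ i ∈ range ((dq n - 4) / 2 + 1), ((2 * i + 1 : ℝ) / ((n : ℝ) - 2 * i))) := Real.sqrt_nonneg _
  have hr0 : (0 : ℝ) ≤ r := Nat.cast_nonneg _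
  -- `Btc ≥ 0` (the zero field is type-constant)
  have hBtc : 0 ≤ Btc := by
    have h0 := htc 0 (fun M p => by simp) (fun M p p' _ => rfl)
    have : ∑ M : PMatch n, ∑ U : OddSet n, levelWeight n t C w U M * (f U.1 *
        (∑ p : Fin n, (0 : PMatch n → Fin n → ℝ) M p * ((if p ∈ U.1 then (1 : ℝ) else 0) * (if M.2.partner p ∈ U.1 then (1 : ℝ) else 0))) ^ 2) = 0 := by
      simp
    linarith
  rcases eq_or_lt_of_le hG0 with hG | hG
  · -- `G = 0`: the mask vanishes
    have hψ : ∀ U, f U = 0 := fun U => le_antisymm (by rw [hG]; exact hfG U) (hf0 U)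
    have hl : ∑ U : OddSet n, ∑ M : PMatch n, levelWeight n t C w U M *
        (f U.1 * ((∑ p, (if p ∈ U.1 then (1 : ℝ) else 0) • β p) * (∑ p, (if p ∈ U.1 then (1 : ℝ) else 0) • β p)ᵀ * Y M).trace) = 0 := by
      simp [hψ]
    rw [hl, ← hG]
    have : 0 ≤ Real.exp (-(a * dq n)) := (Real.exp_pos _).le
    nlinarith [hBtc, hr0, hP, this]
  -- `G > 0`: all directions ≤ type-constant directions + 8Gn⁶γ (brick 148 §4), then brick 150
  have hall : ∀ c : PMatch n → Fin n → ℝ, (∀ M p, |c M p| ≤ 1) → (∀ M p, c M (M.2.partner p) = c M p) →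
      ∑ M : PMatch n, ∑ U : OddSet n, levelWeight n t C w U M * (f U.1 *
        (∑ p : Fin n, c M p * ((if p ∈ U.1 then (1 : ℝ) else 0) * (if M.2.partner p ∈ U.1 then (1 : ℝ) else 0))) ^ 2) ≤
        (Btc + 160 * G * (n : ℝ) ^ 6 * Real.exp (-(a * dq n))) / G * G * 1 := by
    intro c hc hcπ
    have h148 := colourSymmetric_allDirections_reduction ht C w hR col f hG0 hf0 hfG hf c hc hcπ
    have hv := htc (fun M p => (∑ q ∈ univ.filter (fun q => s(col q, col (M.2.partner q)) = s(col p, col (M.2.partner p))), c M q) /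
        ((univ.filter fun q => s(col q, col (M.2.partner q)) = s(col p, col (M.2.partner p))).card : ℝ))
      (fun M p => Summit.PneNP.PneNP.Theorems.ChebyshevTracialDesignAllDirections.abs_classAvg_le_one _ (c M) (hc M))
      (fun M p p' hpp' => by simp only [hpp'])
    rw [div_mul_cancel₀ _ hG.ne', mul_one]
    linarith
  have key := amplitudeOne_of_allDirections hev hn256 hdes f hG0 hf0 hfG hall β hB Y hY
  rw [div_mul_cancel₀ _ hG.ne', mul_one] at key
  exact key

end Summit.PneNP.PneNP.Theorems.ChebyshevTracialDesignColourSymmetricAmplitudeOne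

end
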